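import Summits.BirchSwinnertonDyer.BirchSwinnertonDyer.Theses.BiquadraticEisensteinDescent
import Summits.BirchSwinnertonDyer.BirchSwinnertonDyer.Theorems.BiquadraticEisensteinDescentKatzWaldspurgerFrameCMInertBadFlatBody
import HarnessLib

/-!
# `BiquadraticEisensteinDescent.KatzWaldspurgerFrameCMInertBadFlatOfLZZ` holds (route BiquadraticEisensteinDescent,
# W-ALL row 12 · K12i; item stmt-BirchSwinnertonDyer-20325, rev 10/11 pattern β-W of the tenure planner bsd-wall-cm g4)

The rev-11 decl `KatzWaldspurgerFrameCMInertBadFlatOfLZZ := Hsieh2014.thmA_…_anyLevel →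
LiuZhangZhang2018.thm151_thm153_modularCurve_heegnerVector_additive → <the rev-8 body of (W♭) verbatim>` is, textually,
the statement of the tree theorem `…Theorems.KatzWaldspurgerFrameCMInertBadFlatBody.w9` (p522314, prover seat
bsd-wall-bed-p2 g2: the (W♭) body typed verbatim with the two named print inputs as leading antecedents; proof =
p521367's — ♭-frame from Hsieh Thm. A at any level, exact display from Liu–Zhang–Zhang Duke 167 Thm. 1.5.1/1.5.3 at an
additive prime, X11b one-sided rigidity at `c ≠ 0`, zero-rigidity at `c = 0`). So the item closes by ONE `exact`
(kernel pre-check: HOME/bsd-wall-cm/rev9/GlueBetaWCheck2.lean 402f455d9c1142c4, cm g4 10:29:12Z).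

HONEST FRAMING: THEOREMS ONLY (0 definitions, 0 named facts, 0 `sorry`). The decl is an IMPLICATION whose two antecedents
are the published inputs (route items `HsiehAnyLevelInput` 20456 and `LiuZhangZhangAdditiveInput` 20316, both visible by name
in `closes`); proving it asserts nothing about those inputs. Prover seat bsd-wall-bed-p2 (g3), 2026-08-27.
References: [LiuZhangZhang2018] Duke Math. J. 167 (2018) Thm. 1.5.1, Thm. 1.5.3; [Hsieh2014] Doc. Math. 19 Thm. A;
[Castella2018] Thms. 3.1–3.2 (arXiv:1704.06608).
-/

set_option autoImplicit false

-- D-0017 layout: summit = sub-problem, so `Summit.BirchSwinnertonDyer.BirchSwinnertonDyer.…` is the mandated namespace.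
set_option linter.dupNamespace false

namespace Summit.BirchSwinnertonDyer.BirchSwinnertonDyer.Theorems.BiquadraticEisensteinDescentKatzWaldspurgerFrameCMInertBadFlatOfLZZ

/-- **(W♭) granted its print inputs — the route decl `KatzWaldspurgerFrameCMInertBadFlatOfLZZ` holds**: for every datum of
the CM inert-bad corner over an admissible Heegner field `K′` with `p ∤ c(Dt)`, granted Hsieh Thm. A at any level and the
Liu–Zhang–Zhang `p`-adic Waldspurger formula at an additive prime, there is a ♭-frame whose value at `𝟙` is `u·(log_ω P)²`
with `‖u‖ ≤ 1`. Proof: the tree theorem `KatzWaldspurgerFrameCMInertBadFlatBody.w9` (p522314) has exactly this type.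
[cite: LiuZhangZhang2018, Thm 1.5.1 and Thm 1.5.3 (Duke Math. J. 167 pp. 748–749)]
[cite: Hsieh2014, Thm. A p. 712 (Doc. Math. 19)] -/
theorem katzWaldspurgerFrameCMInertBadFlatOfLZZ_proof :
    Summit.BirchSwinnertonDyer.BirchSwinnertonDyer.Theses.BiquadraticEisensteinDescent.KatzWaldspurgerFrameCMInertBadFlatOfLZZ :=
  Summit.BirchSwinnertonDyer.BirchSwinnertonDyer.Theorems.KatzWaldspurgerFrameCMInertBadFlatBody.w9

end Summit.BirchSwinnertonDyer.BirchSwinnertonDyer.Theorems.BiquadraticEisensteinDescentKatzWaldspurgerFrameCMInertBadFlatOfLZZ
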